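import Literature.NumberTheory.Sieve.AsymptoticSieveForPrimesRough
import Literature.NumberTheory.Sieve.AsymptoticSieveForPrimesBilinearStrong
import HarnessLib

/-!
# Asymptotic sieve for primes under (B*): the reduced sieved bilinear bound with the weight `6^{ω(m)}`

Topic `Literature/NumberTheory/Sieve` (trunk T-SIEVE), a sequel of
`Literature.NumberTheory.Sieve.AsymptoticSieveForPrimesRough`. Source: J. Friedlander, H. Iwaniec,
*Asymptotic sieve for primes*, Ann. of Math. 148 (1998) 1041–1065 [FriedlanderIwaniecASP1998]
(= arXiv:math/9811186), §2 pp. 1046–1048 ((B) ⟹ (B′) "by Hölder's inequality") and §10 p. 1065: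
"By the argument that gave (B) ⟹ (B′) it follows that (B*) implies
`∑_m τ₃(m) |∑*_{N<n≤2N} γ(n) μ(mn) a_{mn}| ≪ A(x)(log x)^{-2^{23}}` (the restriction `(n, Π) = 1` only
helps matters)."

In the proof of Theorem 3 (§10) the sieved bilinear hypothesis (B*) — inner variable `n` free of
prime factors `< P` — is needed with a divisor-type weight on the outer variable `m`: after the
substitution `n = n₀n₁` (`n₁ ∣ Π`) and the reindexing `m ↦ m n₁` of p. 1065 the outer weight of the
bilinear forms met in §7 (`τ₃`) and §8 (`τ(k)² = τ₄(k)` of (8.1)) grows to `τ₄`, resp.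
`(τ₄ ∗ τ₂)(m) = 6^{ω(m)}` on squarefree `m`. This file proves that consequence of (B*) in the form the
sequels consume, for the larger of the two weights:

* `SieveSequence.FIAsymptoticSieveHypothesesRough.reduced_rough_bilinear_bound_six`: under
  `FIAsymptoticSieveHypothesesRough A D δ Δ P`, for every `k ≤ 2^{18}` there is `K` with
  `∑_m 6^{ω(m)} |∑_{N<n≤2N, mn≤x, (n,Π)=1} γ(n;C) μ(mn) a_{mn}| ≤ K A(x)(log x)^{-k}` for all large
  `x`, all `N` in (B1) and `C` in (B3). The proof is that of the tree's `reduced_bilinear_bound_pow`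
  (`…BilinearStrong`): `R₀ = ∑_m |I*_m| ≤ A(x)(log x)^{-2^{26}}` by (B*) (clause of the rough
  hypotheses; stronger than the `(log x)^{-2^{22}}` the tail needs); `|I*_m| ≤ ∑_n τ(n) a_{mn}` (the
  roughness restriction only helps); Hölder with exponents `(4, 4/3)` and the weight `6^{ω(m)}`,
  `6^{4/3} ≤ 11` (`six_rpow_four_thirds_le_eleven`: `6⁴ = 1296 ≤ 1331 = 11³`), so that the second
  moment is `∑_m 11^{ω(m)} ∑_n τ(n) a_{mn} ≤ ∑_k a_k (τ₁₁ ∗ τ₂)(k) = ∑ a_k 13^{ω(k)} ≤ ∑ a_k τ(k)⁴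
  ≪ A(x)(log x)^{2^{20}}` by (2.1) (`sum_a_mul_card_divisors_pow_four_le`, fed the void-bilinear
  embedding of the core clauses), and the numerical tail `holder_tail_le_pow`.
* the Hölder step `SieveSequence.sum_six_pow_mul_le_holder` and the divisor identity
  `sum_divisorsAntidiagonal_eleven_pow_mul_card_divisors_le` (`13^{ω} ≤ 16^{ω} = τ⁴` on squarefree).

## References

* J. Friedlander, H. Iwaniec, *Asymptotic sieve for primes*, Ann. of Math. 148 (1998), 1041–1065,
  §2 (B′) pp. 1046–1048 and §10 p. 1065. [cite: FriedlanderIwaniecASP1998, §2 (B′) and §10 p. 1065]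

## Mathlib / tree search

Tree: `fiBilinearRough`, `FIAsymptoticSieveHypothesesRough` and `.withTrivialBilinear` (`…Rough`),
`holder_tail_le_pow` (`…BilinearStrong`), `sum_sum_le_sum_divisorsAntidiagonal`,
`FIAsymptoticSieveHypotheses.sum_a_mul_card_divisors_pow_four_le`, `card_divisors_of_squarefree`,
`sum_divisorCountK_five_mul_le_holder` (the `τ₅` model, `…Reduction`), `divisorCountK`,
`divisorCountK_apply_of_squarefree` (`…Inputs`), `SieveSequence.abs_fiGamma_le`. Mathlib:
`Real.inner_le_Lp_mul_Lq_of_nonneg` (Hölder). `lean search 'reduced_rough_bilinear|six_pow_mul_le_holder'`: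
nothing before this file.
-/

noncomputable section

open Filter Finset
open scoped ArithmeticFunction.Moebius ArithmeticFunction.sigma ArithmeticFunction.omega

namespace Literature.NumberTheory.Sieve

/-! ### Hölder with the weight `6^{ω}` -/

/-- Numerical inequality `6^{4/3} ≤ 11` (as `1296^{1/3} ≤ 1331^{1/3}`). [folklore] -/
theorem six_rpow_four_thirds_le_eleven : (6 : ℝ) ^ (4 / 3 : ℝ) ≤ 11 := by
  have h6 : (6 : ℝ) ^ (4 / 3 : ℝ) = (1296 : ℝ) ^ (1 / 3 : ℝ) := by
    rw [show (1296 : ℝ) = 6 ^ (4 : ℝ) by norm_num, ← Real.rpow_mul (by norm_num)]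
    norm_num
  have h11 : (11 : ℝ) = (1331 : ℝ) ^ (1 / 3 : ℝ) := by
    rw [show (1331 : ℝ) = 11 ^ (3 : ℝ) by norm_num, ← Real.rpow_mul (by norm_num)]
    norm_num
  rw [h6, h11]
  exact Real.rpow_le_rpow (by norm_num) (by norm_num) (by norm_num)

namespace SieveSequence

/-- **Hölder step with the weight `6^{ω}`**: for nonnegative `r` on a finite set `S`,
`∑_S 6^{ω(d)} r(d) ≤ (∑_S r(d))^{1/4} (∑_S 11^{ω(d)} r(d))^{3/4}` (exponents `4`, `4/3`;
`(6^{ω})^{4/3} = (6^{4/3})^{ω} ≤ 11^{ω}`). Compare `sum_divisorCountK_five_mul_le_holder` (weight `τ₅`,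
`5^{4/3} ≤ 9`). [cite: FriedlanderIwaniecASP1998, §2 (B′) and §10 p. 1065] -/
theorem sum_six_pow_mul_le_holder (S : Finset ℕ) {r : ℕ → ℝ} (hr : ∀ d ∈ S, 0 ≤ r d) :
    ∑ d ∈ S, (6 : ℝ) ^ d.primeFactors.card * r d ≤
      (∑ d ∈ S, r d) ^ (1 / 4 : ℝ) *
        (∑ d ∈ S, (11 : ℝ) ^ d.primeFactors.card * r d) ^ (3 / 4 : ℝ) := by
  have hpq : (4 : ℝ).HolderConjugate (4 / 3) := Real.holderConjugate_iff.mpr ⟨by norm_num, by norm_num⟩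
  have hH := Real.inner_le_Lp_mul_Lq_of_nonneg S hpq
    (f := fun d => r d ^ (1 / 4 : ℝ)) (g := fun d => (6 : ℝ) ^ d.primeFactors.card * r d ^ (3 / 4 : ℝ))
    (fun d hd => Real.rpow_nonneg (hr d hd) _)
    (fun d hd => mul_nonneg (by positivity) (Real.rpow_nonneg (hr d hd) _))
  -- identify the left-hand side
  have hL : ∑ d ∈ S, (6 : ℝ) ^ d.primeFactors.card * r d =
      ∑ d ∈ S, r d ^ (1 / 4 : ℝ) * ((6 : ℝ) ^ d.primeFactors.card * r d ^ (3 / 4 : ℝ)) := by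
    refine Finset.sum_congr rfl fun d hd => ?_
    have : r d ^ (1 / 4 : ℝ) * r d ^ (3 / 4 : ℝ) = r d := by
      rw [← Real.rpow_add' (hr d hd) (by norm_num)]
      norm_num
    calc (6 : ℝ) ^ d.primeFactors.card * r d
        = (6 : ℝ) ^ d.primeFactors.card * (r d ^ (1 / 4 : ℝ) * r d ^ (3 / 4 : ℝ)) := by rw [this]
      _ = _ := by ring
  rw [hL]
  refine hH.trans ?_
  -- first factor
  have h1 : ∑ d ∈ S, (r d ^ (1 / 4 : ℝ)) ^ (4 : ℝ) = ∑ d ∈ S, r d := by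
    refine Finset.sum_congr rfl fun d hd => ?_
    rw [← Real.rpow_mul (hr d hd)]
    norm_num
  -- second factor: `∑ (6^ω r^{3/4})^{4/3} ≤ ∑ 11^ω r`
  have h2 : ∑ d ∈ S, ((6 : ℝ) ^ d.primeFactors.card * r d ^ (3 / 4 : ℝ)) ^ (4 / 3 : ℝ) ≤
      ∑ d ∈ S, (11 : ℝ) ^ d.primeFactors.card * r d := by
    refine Finset.sum_le_sum fun d hd => ?_
    rw [Real.mul_rpow (by positivity) (Real.rpow_nonneg (hr d hd) _), ← Real.rpow_mul (hr d hd)]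
    norm_num
    refine mul_le_mul_of_nonneg_right ?_ (hr d hd)
    rw [← Real.rpow_natCast, ← Real.rpow_natCast (11 : ℝ), ← Real.rpow_mul (by norm_num),
      mul_comm, Real.rpow_mul (by norm_num)]
    exact Real.rpow_le_rpow (by positivity) six_rpow_four_thirds_le_eleven (Nat.cast_nonneg _)
  rw [h1]
  norm_num
  refine mul_le_mul_of_nonneg_left ?_ (Real.rpow_nonneg (Finset.sum_nonneg hr) _)
  exact Real.rpow_le_rpow (Finset.sum_nonneg fun d hd => by
    exact Real.rpow_nonneg (mul_nonneg (by positivity) (Real.rpow_nonneg (hr d hd) _)) _) h2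
    (by norm_num)

end SieveSequence

/-- For squarefree `k`, `∑_{mn = k} 11^{ω(m)} τ(n) = 13^{ω(k)} ≤ τ(k)⁴` (`τ₁₁ ∗ τ₂ = τ₁₃`, `13 ≤ 16`).
Compare `sum_divisorsAntidiagonal_nine_pow_mul_card_divisors_le`. [folklore] -/
theorem sum_divisorsAntidiagonal_eleven_pow_mul_card_divisors_le {k : ℕ} (hk : Squarefree k) :
    ∑ p ∈ k.divisorsAntidiagonal, (11 : ℝ) ^ p.1.primeFactors.card * (p.2.divisors.card : ℝ) ≤
      ((k.divisors.card : ℝ)) ^ 4 := by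
  have hmul : divisorCountK 11 * divisorCountK 2 = divisorCountK 13 := by
    rw [divisorCountK, divisorCountK, divisorCountK, ← pow_add]
  have happ := congrArg (fun f : ArithmeticFunction ℕ => (f k : ℕ)) hmul
  simp only [ArithmeticFunction.mul_apply] at happ
  rw [divisorCountK_apply_of_squarefree 13 hk] at happ
  have hcast : ∑ p ∈ k.divisorsAntidiagonal, (11 : ℝ) ^ p.1.primeFactors.card * (p.2.divisors.card : ℝ) =
      ((13 ^ ω k : ℕ) : ℝ) := by
    rw [← happ]
    push_cast
    refine Finset.sum_congr rfl fun p hp => ?_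
    have hp1 : p.1 ∣ k := Nat.fst_mem_divisors_of_mem_antidiagonal hp |> Nat.dvd_of_mem_divisors
    rw [divisorCountK_apply_of_squarefree 11 (hk.squarefree_of_dvd hp1),
      ← card_primeFactors_eq_cardDistinctFactors]
    have h2 := congrArg (fun f : ArithmeticFunction ℕ => f p.2) divisorCountK_two
    simp only [ArithmeticFunction.sigma_zero_apply] at h2
    rw [h2]
    push_cast
    rfl
  rw [hcast, card_divisors_of_squarefree hk, ← card_primeFactors_eq_cardDistinctFactors]
  push_cast
  rw [← pow_mul, mul_comm, pow_mul]
  norm_num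
  exact pow_le_pow_left₀ (by norm_num) (by norm_num) _

/-! ### The reduced sieved bilinear bound -/

variable {A : SieveSequence} {D δ Δ P : ℝ → ℝ}

/-- **(B*) reduced, with the weight `6^{ω(m)}` and the saving `(log x)^{-k}`, `k ≤ 2^{18}`**
(FI §10 p. 1065: "By the argument that gave (B) ⟹ (B′) it follows that (B*) implies
`∑_m τ₃(m)|∑*_{N<n≤2N} γ(n)μ(mn)a_{mn}| ≪ A(x)(log x)^{-2^{23}}` (the restriction `(n, Π) = 1` only
helps matters)", here with the larger weight `6^{ω(m)}` that the reindexing of (8.1) produces).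
Under `SieveSequence.FIAsymptoticSieveHypothesesRough A D δ Δ P`: for every `k ≤ 2^{18}` there is `K`
such that for all large `x`, every `N` with `Δ⁻¹√D < N < δ⁻¹√x` (B1) and every `1 ≤ C ≤ x/D` (B3),
`∑_{m ≤ x} 6^{ω(m)} |∑_{N<n≤2N, mn≤x, (n,Π)=1} γ(n;C) μ(mn) a_{mn}| ≤ K A(x)(log x)^{-k}`.
[cite: FriedlanderIwaniecASP1998, §10 p. 1065 and §2 (B′)] -/
theorem SieveSequence.FIAsymptoticSieveHypothesesRough.reduced_rough_bilinear_bound_six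
    (h : A.FIAsymptoticSieveHypothesesRough D δ Δ P) {k : ℕ} (hk : k ≤ 2 ^ 18) :
    ∃ K : ℝ, ∀ᶠ x : ℝ in atTop, ∀ N : ℝ, Real.sqrt (D x) / Δ x < N → N < Real.sqrt x / δ x →
      ∀ C : ℝ, 1 ≤ C → C ≤ x / D x →
        ∑ m ∈ Icc 1 ⌊x⌋₊, (6 : ℝ) ^ m.primeFactors.card *
          |∑ n ∈ (Ioc ⌊N⌋₊ ⌊2 * N⌋₊).filter
              (fun n : ℕ => ((m * n : ℕ) : ℝ) ≤ x ∧ ∀ p ∈ n.primeFactors, P x ≤ (p : ℝ)),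
            (SieveSequence.fiGamma C n : ℝ) * (μ (m * n) : ℝ) * A.a (m * n)| ≤
          K * A.size x / Real.log x ^ k := by
  have hT := h.withTrivialBilinear
  obtain ⟨K₆, h16⟩ := h.core.2.2.1
  have hB := h.bilinear
  set C₁ : ℝ := 2 ^ 12 * max K₆ 0 * Real.exp (2 ^ 22) with hC₁
  have hC₁0 : 0 ≤ C₁ := by positivity
  refine ⟨C₁ + 1, ?_⟩
  filter_upwards [h16, hB, eventually_ge_atTop (8 : ℝ)] with x h16x hBx hx8 N hN1 hN2 C hC1 hC2
  classical
  -- basics at `x`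
  have hx1 : (1 : ℝ) < x := by linarith
  set L : ℝ := Real.log x with hLdef
  have hL1 : 1 ≤ L := by
    rw [hLdef, ← Real.log_exp 1]
    refine Real.log_le_log (Real.exp_pos 1) ?_
    have := Real.exp_one_lt_d9
    linarith
  have hL0 : 0 < L := by linarith
  have hA0 : 0 ≤ A.size x := by rw [hT.size_eq]; exact A.congrSum_nonneg 1 x
  set M := Icc 1 ⌊x⌋₊ with hMdef
  set F : ℕ → Finset ℕ := fun m => (Ioc ⌊N⌋₊ ⌊2 * N⌋₊).filter
    (fun n : ℕ => ((m * n : ℕ) : ℝ) ≤ x ∧ ∀ p ∈ n.primeFactors, P x ≤ (p : ℝ)) with hFdef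
  set I : ℕ → ℝ := fun m =>
    ∑ n ∈ F m, (SieveSequence.fiGamma C n : ℝ) * (μ (m * n) : ℝ) * A.a (m * n) with hIdef
  -- (B*): `R₀ ≤ A (log x)^{-2^26} ≤ A (log x)^{-2^22}`
  have hB0 : ∑ m ∈ M, |I m| ≤ A.size x * L ^ (-(2 ^ 22 : ℝ)) := by
    have h0 := hBx N hN1 hN2 C hC1 hC2
    rw [SieveSequence.fiBilinearRough] at h0
    refine h0.trans ?_
    rw [Real.rpow_neg hL0.le, ← div_eq_mul_inv]
    refine div_le_div_of_nonneg_left hA0 (Real.rpow_pos_of_pos hL0 _) ?_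
    calc L ^ (2 ^ 22 : ℝ) = L ^ ((2 ^ 22 : ℕ) : ℝ) := by norm_num
      _ = L ^ (2 ^ 22 : ℕ) := Real.rpow_natCast L (2 ^ 22)
      _ ≤ L ^ (2 ^ 26 : ℕ) := pow_le_pow_right₀ hL1 (by norm_num)
  -- `R₁`
  have hR1' : ∑ m ∈ M, (11 : ℝ) ^ m.primeFactors.card * |I m| ≤ C₁ * A.size x * L ^ (2 ^ 20 : ℝ) := by
    have hIle : ∀ m, |I m| ≤ ∑ n ∈ F m, ((n.divisors.card : ℝ)) * A.a (m * n) := by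
      intro m
      refine (Finset.abs_sum_le_sum_abs _ _).trans (Finset.sum_le_sum fun n _ => ?_)
      rw [abs_mul, abs_mul, abs_of_nonneg (A.a_nonneg _)]
      have hγ : |(SieveSequence.fiGamma C n : ℝ)| ≤ (n.divisors.card : ℝ) := by
        have := SieveSequence.abs_fiGamma_le C n
        rw [ArithmeticFunction.sigma_zero_apply] at this
        exact_mod_cast this
      have hμ : |(μ (m * n) : ℝ)| ≤ 1 := by exact_mod_cast ArithmeticFunction.abs_moebius_le_one
      calc |(SieveSequence.fiGamma C n : ℝ)| * |(μ (m * n) : ℝ)| * A.a (m * n)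
          ≤ (n.divisors.card : ℝ) * 1 * A.a (m * n) := by gcongr; exact A.a_nonneg _
        _ = (n.divisors.card : ℝ) * A.a (m * n) := by ring
    calc ∑ m ∈ M, (11 : ℝ) ^ m.primeFactors.card * |I m|
        ≤ ∑ m ∈ M, ∑ n ∈ F m, (11 : ℝ) ^ m.primeFactors.card * ((n.divisors.card : ℝ)) * A.a (m * n) := by
          refine Finset.sum_le_sum fun m _ => ?_
          rw [show ∑ n ∈ F m, (11 : ℝ) ^ m.primeFactors.card * ((n.divisors.card : ℝ)) * A.a (m * n) =
            (11 : ℝ) ^ m.primeFactors.card * ∑ n ∈ F m, ((n.divisors.card : ℝ)) * A.a (m * n) by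
            rw [Finset.mul_sum]; refine Finset.sum_congr rfl fun n _ => by ring]
          exact mul_le_mul_of_nonneg_left (hIle m) (by positivity)
      _ ≤ ∑ k ∈ Ioc 0 ⌊x⌋₊, ∑ p ∈ k.divisorsAntidiagonal,
            (11 : ℝ) ^ p.1.primeFactors.card * ((p.2.divisors.card : ℝ)) * A.a (p.1 * p.2) := by
          refine sum_sum_le_sum_divisorsAntidiagonal (f := fun m n =>
            (11 : ℝ) ^ m.primeFactors.card * ((n.divisors.card : ℝ)) * A.a (m * n))
            (fun m n => mul_nonneg (by positivity) (A.a_nonneg _)) ⌊x⌋₊ M F fun m hm n hn => ?_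
          obtain ⟨hm1, -⟩ := Finset.mem_Icc.mp hm
          obtain ⟨hn1, hn2⟩ := Finset.mem_filter.mp hn
          refine ⟨hm1, Nat.succ_le_of_lt (lt_of_le_of_lt (Nat.zero_le _) (Finset.mem_Ioc.mp hn1).1), ?_⟩
          exact Nat.le_floor hn2.1
      _ = ∑ k ∈ Ioc 0 ⌊x⌋₊, A.a k * ∑ p ∈ k.divisorsAntidiagonal,
            (11 : ℝ) ^ p.1.primeFactors.card * ((p.2.divisors.card : ℝ)) := by
          refine Finset.sum_congr rfl fun k _ => ?_
          rw [Finset.mul_sum]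
          refine Finset.sum_congr rfl fun p hp => ?_
          rw [(Nat.mem_divisorsAntidiagonal.mp hp).1]
          ring
      _ ≤ ∑ k ∈ Ioc 0 ⌊x⌋₊, A.a k * ((k.divisors.card : ℝ)) ^ 4 := by
          refine Finset.sum_le_sum fun k _ => ?_
          by_cases hsq : Squarefree k
          · exact mul_le_mul_of_nonneg_left
              (sum_divisorsAntidiagonal_eleven_pow_mul_card_divisors_le hsq) (A.a_nonneg k)
          · rw [hT.a_eq_zero hsq, zero_mul, zero_mul]
      _ ≤ C₁ * A.size x * L ^ (2 ^ 20 : ℝ) := hT.sum_a_mul_card_divisors_pow_four_le hx8 h16x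
  -- Hölder and the numerical tail
  have hH := SieveSequence.sum_six_pow_mul_le_holder M (r := fun m => |I m|)
    (fun m _ => abs_nonneg _)
  refine hH.trans ?_
  exact holder_tail_le_pow hk hA0 hL1 hC₁0 (Finset.sum_nonneg fun m _ => abs_nonneg _)
    (Finset.sum_nonneg fun m _ => mul_nonneg (by positivity) (abs_nonneg _)) hB0 hR1'

end Literature.NumberTheory.Sieve
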